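import Mathlib
import Summits.CriticalPhenomena.CardyFormulaZ2.Theorems.CardyMagicRigidityMagicFormulaTAprioriMoments
import Summits.CriticalPhenomena.CardyFormulaZ2.Theorems.CardyMagicRigidityMagicFormulaTAprioriGeometry
import HarnessLib

/-!
# A priori bounds for the site-`𝕋` loop ensemble (crux `MagicFormulaT`, stub A = `stub_aprioriBounds`)

Crux `Summit.CriticalPhenomena.CardyFormulaZ2.Theses.CardyMagicRigidity.MagicFormulaT`
(stmt-CriticalPhenomena-4836), line `Sketch`, skeleton v7 (lead c3).  The registered skeleton stub
`stub_aprioriBounds` is the conjunction of its four landed sub-goals (wave 1):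
`apriori_sqMoment` (uniform second moments of the truncated nesting weights, K6) and `apriori_countTight`
(tightness of the number of loops of diameter `≥ η` meeting `B̄(0,R)`, K6 + Markov), both in
`CardyMagicRigidityMagicFormulaTAprioriMoments` (p142040); `apriori_window` (loops meeting `B̄(0,R)` stay in a
large ball, one-arm/RSW) and `apriori_sausage` (thin `ε`-sausages, first-moment loop-crossing bound + Markov),
both in `CardyMagicRigidityMagicFormulaTAprioriGeometry` (p142025).  Pure glue.
-/

noncomputable section

namespace Summit.CriticalPhenomena.CardyFormulaZ2.Cruxes.MagicFormulaT.LineSketch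

open MeasureTheory Filter Set
open scoped Real Topology BigOperators ENNReal
open Literature.Probability.RandomPlanarGeometry Literature.Probability.Percolation
  Literature.Probability.LatticeModels

/-- **Stub A (`stub_aprioriBounds`, registered, verbatim signature)**: the four a priori bounds, uniform in the
mesh — second moments, count tightness, window, sausages — assembled from the landed sub-goals. -/
theorem stub_aprioriBounds :
    (∀ (f : ℂ → ℝ) (R C : ℝ), Measurable f → (∀ z, |f z| ≤ C) → (∀ z, R < ‖z‖ → f z = 0) → ∫ z, f z = 0 →
      ∀ η : ℝ, 0 < η → ∃ B δ₀ : ℝ, 0 < B ∧ 0 < δ₀ ∧ ∀ δ η' : ℝ, 0 < δ → δ ≤ δ₀ → η ≤ η' →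
        Integrable (fun ω ↦ (siteLoopConfig δ ω).truncNestingWeight f η' ^ 2) (triSitePercolation half) ∧
        ∫ ω, (siteLoopConfig δ ω).truncNestingWeight f η' ^ 2 ∂(triSitePercolation half) ≤ B) ∧
    (∀ (R η κ : ℝ), 0 < η → 0 < κ → ∃ N₀ : ℕ, ∃ δ₀ : ℝ, 0 < δ₀ ∧ ∀ δ : ℝ, 0 < δ → δ ≤ δ₀ →
      (triSitePercolation half) {ω | ¬ ({u ∈ (siteLoopConfig δ ω).loops |
          (u.range ∩ Metric.closedBall (0 : ℂ) R).Nonempty ∧ η ≤ Metric.diam u.range}.Finite ∧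
        {u ∈ (siteLoopConfig δ ω).loops |
          (u.range ∩ Metric.closedBall (0 : ℂ) R).Nonempty ∧ η ≤ Metric.diam u.range}.ncard ≤ N₀)} ≤
        ENNReal.ofReal κ) ∧
    (∀ (R κ : ℝ), 0 < κ → ∃ D δ₀ : ℝ, 0 < D ∧ 0 < δ₀ ∧ ∀ δ : ℝ, 0 < δ → δ ≤ δ₀ →
      (triSitePercolation half) {ω | ∃ u ∈ (siteLoopConfig δ ω).loops,
        (u.range ∩ Metric.closedBall (0 : ℂ) R).Nonempty ∧ ¬ (u.range ⊆ Metric.ball (0 : ℂ) D)} ≤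
        ENNReal.ofReal κ) ∧
    (∀ (R η τ κ : ℝ), 0 < η → 0 < τ → 0 < κ → ∃ ε₀ : ℝ, 0 < ε₀ ∧ ∀ ε : ℝ, 0 < ε → ε ≤ ε₀ →
      ∃ δ₀ : ℝ, 0 < δ₀ ∧ ∀ δ : ℝ, 0 < δ → δ ≤ δ₀ →
        (triSitePercolation half) {ω | ∃ u ∈ (siteLoopConfig δ ω).loops,
          (u.range ∩ Metric.closedBall (0 : ℂ) (R + 1)).Nonempty ∧ η ≤ Metric.diam u.range ∧
          τ < volume.real ({z : ℂ | Metric.infDist z u.range ≤ ε} ∩ Metric.closedBall (0 : ℂ) R)} ≤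
          ENNReal.ofReal κ) :=
  ⟨apriori_sqMoment, apriori_countTight, apriori_window, apriori_sausage⟩

end Summit.CriticalPhenomena.CardyFormulaZ2.Cruxes.MagicFormulaT.LineSketch

end
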